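import Literature.NumberTheory.Automorphic.QuadraticAdeleBaseChange
import Literature.NumberTheory.Automorphic.UnitaryGroupTraceZeroLattice
import Literature.NumberTheory.Automorphic.UnitaryGroupHeisenbergHaar
import Literature.NumberTheory.Automorphic.MeyerDifferenceRepresentation
import HarnessLib

/-!
# The line dictionary `θ : 𝔸_F ≃ 𝔸_E⁻`, `t ↦ (t ⊗ 1) · δ` (trace-zero adeles of a quadratic extension as a
# copy of the base adeles)

Topic `NumberTheory/Automorphic`; namespace `Literature.NumberTheory.Automorphic.UnitaryGroup`.
DEFINITIONS with bodies (`traceZeroLine`, `rationalTraceZeroEquiv`) + proved theorems; no named fact,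
no `sorry`, no instance, no notation.

Setting: a quadratic extension `E/F` of number fields (`[Algebra.IsQuadraticExtension F E]`) with
involution `c ∈ Aut(E/F)` and a trace-zero unit `δ ∈ E`, `c δ = -δ ≠ 0`, so that `E = F ⊕ F δ` and
`𝔸_E = (𝔸_F ⊗ 1) ⊕ (𝔸_F ⊗ 1) δ` (★ `quadraticAdeleEquiv c : 𝔸_F × 𝔸_F ≃ₜ+ 𝔸_E` of
`QuadraticAdeleBaseChange`). The second summand is exactly the group of trace-zero adeles
`𝔸_E⁻ = traceZeroAdele F E c = {x | (c ⊗ 1) x = -x}` (★ `UnitaryGroupGlobalGenericity`), the centre of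
the Heisenberg group `N(𝔸_F)` of the quasi-split `U(3)`.

* §1 **`traceZeroLine F E c hcδ hδ : 𝔸_F ≃ₜ+ 𝔸_E⁻`**, `t ↦ (t ⊗ 1) · δ` (inverse: the second quadratic
  coordinate), `coe_traceZeroLine`;
* §2 semilinearity: `θ (a t) = (a ⊗ 1) θ(t)`, i.e. `θ ∘ (a ·) = smulTraceZero (a ⊗ 1) ∘ θ` for an idele
  `a` of `F` (★ `smulTraceZero` of `UnitaryGroupHeisenbergHaar`), and quadratic GALOIS DESCENT: an adele
  (idele) of `E` is `c`-fixed iff it is `a ⊗ 1` for a (unique) adele (idele) `a` of `F`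
  (`exists_baseChange_eq_of_conjAdele_eq`, `exists_ideleBaseChange_eq_of_conjAdele_eq`) — so every
  `c`-fixed idele scaling of `𝔸_E⁻` is read through `θ`;
* §3 rational points: `θ(F) = E⁻ = rationalTraceZero F E c` (★ `UnitaryGroupTraceZeroLattice`),
  `rationalTraceZeroEquiv : F ≃+ E⁻`, and the LATTICE-SUM DICTIONARY
  **`ideleSum F (ψ ∘ θ) a = ∑' w : E⁻ ∖ 0, ψ ((a ⊗ 1) w)`** (★ `ideleSum` of
  `MeyerDifferenceRepresentation`: `Σ_{ξ ∈ Fˣ} f(ξ a)`);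
* (sequel `UnitaryGroupTraceZeroLineHaar`, theorems only) §4 Haar measures along `θ`; §5 the MODULE
  DICTIONARY `traceZeroModulus (a ⊗ 1) = ‖a‖_{𝔸_F}`.

This is the dictionary by which the centre-line integrals of Rogawski's computation of the singular
semisimple term [Rogawski1990, §7.2, proof of Prop. 7.2.2, (7.2.3): the sum over `t ∈ F^*` of
`ψ(α₃(m)⁻¹ t δ₀)` and Tate's zeta integral over `F^*∖I_F`] become Tate integrals over the ideles of
`F` (★ `TateTruncatedZetaIntegral*`, Lemma 7.1.1, with `K := F`, `f := ψ ∘ θ`). Classical content: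
`𝔸_E = 𝔸_F ⊗_F E` [CasselsFrohlichANT1967, Ch. II §14] in the basis `(1, δ)`; the module of an idele is
its norm [CasselsFrohlichANT1967, Ch. XV (Tate) Lemma 4.1.2].

Cell `hodgecm-mathlib`, ENGINE T1 LAW 5 (L5-iii-c) piece (c2). HC_CM is proved only modulo the 7
printed citations until rung 0 closes — nothing here bears on a summit statement.

## References
* [CasselsFrohlichANT1967] J. W. S. Cassels, A. Fröhlich (eds.), *Algebraic Number Theory* (1967),
  Ch. II (Cassels) §14; Ch. XV (Tate) §4.1, Lemma 4.1.2.
* [Rogawski1990] J. D. Rogawski, *Automorphic Representations of Unitary Groups in Three Variables*,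
  Ann. of Math. Stud. 123 (1990), §1.10, §7.2 (7.2.3).
-/

set_option autoImplicit false

noncomputable section

open NumberField IsDedekindDomain Topology MeasureTheory Measure Set
open scoped Pointwise NNReal ENNReal

namespace Literature.NumberTheory.Automorphic

namespace UnitaryGroup

variable {F : Type} (E : Type) [Field F] [NumberField F] [Field E] [NumberField E] [Algebra F E]
  (c : E ≃ₐ[F] E) {δ : E}

/-! ## §0 Algebra of the quadratic extension `E = F ⊕ F δ` -/

/-- In `E = F ⊕ F δ` with `c δ = -δ ≠ 0`, **every trace-zero element is an `F`-multiple of `δ`**: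
`c e = -e ⟹ e = x δ`, `x ∈ F` (write `e = a + b δ`; `c` gives `-e = a - b δ`, so `2a = 0`) — `E⁰ = F δ₀`,
the identification behind Rogawski's transfer `t ↦ t δ₀`. [cite: Rogawski1990, §7.2 p. 95] -/
theorem exists_eq_algebraMap_mul_of_conj_eq_neg [Algebra.IsQuadraticExtension F E] (hcδ : c δ = -δ)
    (hδ : δ ≠ 0) {e : E} (he : c e = -e) : ∃ x : F, e = algebraMap F E x * δ := by
  obtain ⟨a, b, h⟩ := exists_eq_add_mul_of_isQuadraticExtension E
    (not_mem_range_algebraMap_of_apply_eq_neg E c hcδ hδ) e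
  have hc2 : c e = algebraMap F E a - algebraMap F E b * δ := by
    rw [h, map_add, map_mul, AlgEquiv.commutes, AlgEquiv.commutes, hcδ, mul_neg, sub_eq_add_neg]
  have ha : (2 : E) * algebraMap F E a = 0 := by
    have e2 := hc2.symm.trans he
    rw [h] at e2
    linear_combination e2
  have ha0 : algebraMap F E a = 0 := (mul_eq_zero.1 ha).resolve_left two_ne_zero
  exact ⟨b, by rw [h, ha0, zero_add]⟩

omit [NumberField F] in
/-- `(c ⊗ 1)(δ) = -δ` in `𝔸_E` for the diagonal image of a trace-zero `δ` (plumbing). [folklore] -/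
private theorem conjAdele_algebraMap_of_conj_eq_neg (hcδ : c δ = -δ) :
    conjAdele F E c (algebraMap E (AdeleRing (𝓞 E) E) δ) = -algebraMap E (AdeleRing (𝓞 E) E) δ := by
  rw [← algebraMap_conj, RingHom.coe_coe, hcδ, map_neg]

/-- **`(t ⊗ 1) · δ` is a trace-zero adele** for every adele `t` of `F` (the line `t ↦ t δ₀` lands in
`𝐄⁰ = 𝔸_E⁻`). [cite: Rogawski1990, §7.2 p. 95] -/
theorem baseChange_mul_algebraMap_mem_traceZeroAdele (hcδ : c δ = -δ) (t : AdeleRing (𝓞 F) F) :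
    AdeleRing.baseChange F E t * algebraMap E (AdeleRing (𝓞 E) E) δ ∈ traceZeroAdele F E c := by
  rw [mem_traceZeroAdele_iff, map_mul, conjAdele_algebraMap_of_conj_eq_neg E c hcδ, conjAdele_apply,
    AdeleRing.smul_baseChange, mul_neg]

/-- `½ · (t + t) = t` in `𝔸_F`: doubling is injective on the adeles of a number field (plumbing). [folklore] -/
private theorem adele_eq_zero_of_add_self_eq_zero {t : AdeleRing (𝓞 F) F} (h : t + t = 0) : t = 0 := by
  have h2 : algebraMap F (AdeleRing (𝓞 F) F) 2⁻¹ * (t + t) = t := by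
    rw [← two_mul, ← mul_assoc, ← map_ofNat (algebraMap F (AdeleRing (𝓞 F) F)) 2, ← map_mul,
      inv_mul_cancel₀ (two_ne_zero : (2 : F) ≠ 0), map_one, one_mul]
  rw [← h2, h, mul_zero]

/-! ## §1 The line `θ : 𝔸_F ≃ₜ+ 𝔸_E⁻`, `t ↦ (t ⊗ 1) · δ` -/

section Line

variable [Algebra.IsQuadraticExtension F E]

/-- The quadratic coordinates of a trace-zero adele: **the first coordinate vanishes**, i.e.
`y = (b ⊗ 1) δ` with `b` the second coordinate of `y` (apply `c ⊗ 1` to `y = (a ⊗ 1) + (b ⊗ 1) δ`).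
[cite: CasselsFrohlichANT1967, Ch. II §14] -/
theorem fst_quadraticAdeleEquiv_symm_eq_zero (hcδ : c δ = -δ) (hδ : δ ≠ 0) (y : traceZeroAdele F E c) :
    ((quadraticAdeleEquiv F E c hcδ hδ).symm (y : AdeleRing (𝓞 E) E)).1 = 0 := by
  set p := (quadraticAdeleEquiv F E c hcδ hδ).symm (y : AdeleRing (𝓞 E) E) with hp
  have hy : (y : AdeleRing (𝓞 E) E) = quadraticAdeleEquiv F E c hcδ hδ p := by
    rw [hp, ContinuousAddEquiv.apply_symm_apply]
  have hcy : conjAdele F E c (y : AdeleRing (𝓞 E) E) = quadraticAdeleEquiv F E c hcδ hδ (p.1, -p.2) := by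
    rw [hy, quadraticAdeleEquiv_apply, quadraticAdeleEquiv_apply, map_add, map_mul,
      conjAdele_algebraMap_of_conj_eq_neg E c hcδ, conjAdele_apply, conjAdele_apply, AdeleRing.smul_baseChange,
      AdeleRing.smul_baseChange, map_neg, mul_neg, neg_mul]
  have hny : -(y : AdeleRing (𝓞 E) E) = quadraticAdeleEquiv F E c hcδ hδ (-p.1, -p.2) := by
    rw [hy, ← map_neg]; rfl
  have hmem := (mem_traceZeroAdele_iff _).1 y.2
  rw [hcy, hny] at hmem
  have h12 := (quadraticAdeleEquiv F E c hcδ hδ).injective hmem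
  have h1 : p.1 = -p.1 := congrArg Prod.fst h12
  have h11 : p.1 + p.1 = 0 := by
    nth_rw 2 [h1]
    exact add_neg_cancel p.1
  exact adele_eq_zero_of_add_self_eq_zero h11

variable (F) in
/-- **The line dictionary `θ : 𝔸_F ≃ₜ+ 𝔸_E⁻`, `t ↦ (t ⊗ 1) · δ`**: for a quadratic extension `E/F` of
number fields with involution `c` and `c δ = -δ ≠ 0`, multiplication by `δ` after base change is an
isomorphism of topological groups from the adeles of `F` onto the trace-zero adeles of `E` (the second
quadratic coordinate of ★ `quadraticAdeleEquiv` is its inverse). This is Rogawski's identification of the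
centre `Z(𝔸) ≅ 𝔸_E⁻` of the Heisenberg group with a copy of `𝔸_F` along `t ↦ t δ₀`.
[cite: CasselsFrohlichANT1967, Ch. II §14] [cite: Rogawski1990, §1.10] -/
def traceZeroLine (hcδ : c δ = -δ) (hδ : δ ≠ 0) : AdeleRing (𝓞 F) F ≃ₜ+ traceZeroAdele F E c :=
  { toFun := fun t => ⟨AdeleRing.baseChange F E t * algebraMap E (AdeleRing (𝓞 E) E) δ,
      baseChange_mul_algebraMap_mem_traceZeroAdele E c hcδ t⟩
    invFun := fun y => ((quadraticAdeleEquiv F E c hcδ hδ).symm (y : AdeleRing (𝓞 E) E)).2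
    left_inv := fun t => by
      have h : quadraticAdeleEquiv F E c hcδ hδ (0, t) =
          AdeleRing.baseChange F E t * algebraMap E (AdeleRing (𝓞 E) E) δ := by
        rw [quadraticAdeleEquiv_apply, map_zero, zero_add]
      change ((quadraticAdeleEquiv F E c hcδ hδ).symm
        (AdeleRing.baseChange F E t * algebraMap E (AdeleRing (𝓞 E) E) δ)).2 = t
      rw [← h, ContinuousAddEquiv.symm_apply_apply]
    right_inv := fun y => by
      apply Subtype.ext
      change AdeleRing.baseChange F E ((quadraticAdeleEquiv F E c hcδ hδ).symm (y : AdeleRing (𝓞 E) E)).2 *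
          algebraMap E (AdeleRing (𝓞 E) E) δ = (y : AdeleRing (𝓞 E) E)
      have h0 := fst_quadraticAdeleEquiv_symm_eq_zero E c hcδ hδ y
      conv_rhs => rw [← (quadraticAdeleEquiv F E c hcδ hδ).apply_symm_apply (y : AdeleRing (𝓞 E) E),
        quadraticAdeleEquiv_apply, h0, map_zero, zero_add]
    map_add' := fun s t => Subtype.ext (by
      change AdeleRing.baseChange F E (s + t) * algebraMap E (AdeleRing (𝓞 E) E) δ =
        AdeleRing.baseChange F E s * algebraMap E (AdeleRing (𝓞 E) E) δ +
          AdeleRing.baseChange F E t * algebraMap E (AdeleRing (𝓞 E) E) δ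
      rw [map_add, add_mul])
    continuous_toFun := ((AdeleRing.continuous_baseChange F E).mul continuous_const).subtype_mk _
    continuous_invFun := continuous_snd.comp
      ((quadraticAdeleEquiv F E c hcδ hδ).symm.continuous.comp continuous_subtype_val) }

variable (hcδ : c δ = -δ) (hδ : δ ≠ 0)

/-- `θ(t) = (t ⊗ 1) · δ` as an adele (definitional). [cite: Rogawski1990, §1.10] -/
@[simp] theorem coe_traceZeroLine (t : AdeleRing (𝓞 F) F) :
    ((traceZeroLine F E c hcδ hδ t : traceZeroAdele F E c) : AdeleRing (𝓞 E) E) =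
      AdeleRing.baseChange F E t * algebraMap E (AdeleRing (𝓞 E) E) δ := rfl

/-- `θ⁻¹(y)` is the second quadratic coordinate of `y` (definitional). [cite: CasselsFrohlichANT1967, Ch. II §14] -/
theorem traceZeroLine_symm_apply (y : traceZeroAdele F E c) :
    (traceZeroLine F E c hcδ hδ).symm y = ((quadraticAdeleEquiv F E c hcδ hδ).symm (y : AdeleRing (𝓞 E) E)).2 := rfl

/-- `θ(t) = Ψ_𝔸(0, t)`: the line is the second quadratic coordinate axis. [cite: CasselsFrohlichANT1967, Ch. II §14] -/
theorem quadraticAdeleEquiv_zero_eq_traceZeroLine (t : AdeleRing (𝓞 F) F) :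
    quadraticAdeleEquiv F E c hcδ hδ (0, t) = (traceZeroLine F E c hcδ hδ t : AdeleRing (𝓞 E) E) := by
  rw [quadraticAdeleEquiv_apply, map_zero, zero_add, coe_traceZeroLine]

/-- A trace-zero adele in quadratic coordinates: `y = Ψ_𝔸(0, θ⁻¹ y)`. [cite: CasselsFrohlichANT1967, Ch. II §14] -/
theorem quadraticAdeleEquiv_symm_coe (y : traceZeroAdele F E c) :
    (quadraticAdeleEquiv F E c hcδ hδ).symm (y : AdeleRing (𝓞 E) E) = (0, (traceZeroLine F E c hcδ hδ).symm y) :=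
  Prod.ext (fst_quadraticAdeleEquiv_symm_eq_zero E c hcδ hδ y) rfl

/-! ## §2 Semilinearity `θ(a t) = (a ⊗ 1) θ(t)` and quadratic Galois descent for `c`-fixed adeles / ideles -/

/-- **`θ(a t) = (a ⊗ 1) · θ(t)`** for adeles `a, t` of `F`. [cite: CasselsFrohlichANT1967, Ch. II §14] -/
theorem coe_traceZeroLine_mul (a t : AdeleRing (𝓞 F) F) :
    ((traceZeroLine F E c hcδ hδ (a * t) : traceZeroAdele F E c) : AdeleRing (𝓞 E) E) =
      AdeleRing.baseChange F E a * (traceZeroLine F E c hcδ hδ t : AdeleRing (𝓞 E) E) := by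
  rw [coe_traceZeroLine, coe_traceZeroLine, map_mul, mul_assoc]

omit [Algebra.IsQuadraticExtension F E] in
/-- The base change `a ⊗ 1` of an idele of `F` is `c ⊗ 1`-fixed (named, for use as the proof argument of
★ `smulTraceZero` / ★ `traceZeroModulus`): `𝔸_F ⊗ 1 ⊆ 𝔸_E` is fixed by `Gal(E/F)`.
[cite: CasselsFrohlichANT1967, Ch. II §14] -/
theorem conjAdele_ideleBaseChange (a : (AdeleRing (𝓞 F) F)ˣ) :
    conjAdele F E c ((AdeleRing.ideleBaseChange F E a : (AdeleRing (𝓞 E) E)ˣ) : AdeleRing (𝓞 E) E) =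
      ((AdeleRing.ideleBaseChange F E a : (AdeleRing (𝓞 E) E)ˣ) : AdeleRing (𝓞 E) E) := by
  rw [AdeleRing.coe_ideleBaseChange, conjAdele_apply, AdeleRing.smul_baseChange]

/-- **`θ ∘ (a ·) = smulTraceZero (a ⊗ 1) ∘ θ`**: the line dictionary intertwines multiplication by an
idele `a` of `F` on `𝔸_F` with the scaling of `𝔸_E⁻` by the `c`-fixed idele `a ⊗ 1`
(★ `smulTraceZero`). [cite: Rogawski1990, §1.10] -/
theorem traceZeroLine_units_mul (a : (AdeleRing (𝓞 F) F)ˣ) (t : AdeleRing (𝓞 F) F) :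
    traceZeroLine F E c hcδ hδ ((a : AdeleRing (𝓞 F) F) * t) =
      smulTraceZero (AdeleRing.ideleBaseChange F E a) (conjAdele_ideleBaseChange E c a)
        (traceZeroLine F E c hcδ hδ t) :=
  Subtype.ext (by rw [coe_traceZeroLine_mul, coe_smulTraceZero, AdeleRing.coe_ideleBaseChange])

/-- The same with the scalar on the right: `θ(t a) = (a ⊗ 1) · θ(t)`. [cite: Rogawski1990, §1.10] -/
theorem traceZeroLine_mul_units (a : (AdeleRing (𝓞 F) F)ˣ) (t : AdeleRing (𝓞 F) F) :
    traceZeroLine F E c hcδ hδ (t * (a : AdeleRing (𝓞 F) F)) =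
      smulTraceZero (AdeleRing.ideleBaseChange F E a) (conjAdele_ideleBaseChange E c a)
        (traceZeroLine F E c hcδ hδ t) := by
  rw [mul_comm, traceZeroLine_units_mul]

/-- As functions: `θ ∘ (a ·) = smulTraceZero (a ⊗ 1) ∘ θ`. [cite: Rogawski1990, §1.10] -/
theorem traceZeroLine_comp_mul_left (a : (AdeleRing (𝓞 F) F)ˣ) :
    (traceZeroLine F E c hcδ hδ : AdeleRing (𝓞 F) F → traceZeroAdele F E c) ∘ (fun t => (a : AdeleRing (𝓞 F) F) * t) =
      smulTraceZero (AdeleRing.ideleBaseChange F E a) (conjAdele_ideleBaseChange E c a) ∘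
        (traceZeroLine F E c hcδ hδ : AdeleRing (𝓞 F) F → traceZeroAdele F E c) :=
  funext fun t => traceZeroLine_units_mul E c hcδ hδ a t

include hcδ hδ in
/-- **Quadratic Galois descent for adeles**: a `c ⊗ 1`-fixed adele of `E` is the base change `a ⊗ 1` of
an adele `a` of `F` (its second quadratic coordinate vanishes). (The general Galois statement is
★ `AdeleRing.mem_range_baseChange_iff` of `AdeleGaloisDescent`; here the quadratic case, from the
coordinates.) [cite: CasselsFrohlichANT1967, Ch. II §14] -/
theorem exists_baseChange_eq_of_conjAdele_eq {x : AdeleRing (𝓞 E) E} (hx : conjAdele F E c x = x) :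
    ∃ a : AdeleRing (𝓞 F) F, AdeleRing.baseChange F E a = x := by
  set p := (quadraticAdeleEquiv F E c hcδ hδ).symm x with hp
  have hy : x = quadraticAdeleEquiv F E c hcδ hδ p := by rw [hp, ContinuousAddEquiv.apply_symm_apply]
  have hcy : conjAdele F E c x = quadraticAdeleEquiv F E c hcδ hδ (p.1, -p.2) := by
    rw [hy, quadraticAdeleEquiv_apply, quadraticAdeleEquiv_apply, map_add, map_mul,
      conjAdele_algebraMap_of_conj_eq_neg E c hcδ, conjAdele_apply, conjAdele_apply, AdeleRing.smul_baseChange,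
      AdeleRing.smul_baseChange, map_neg, mul_neg, neg_mul]
  rw [hcy, hy] at hx
  have h2 : -p.2 = p.2 := congrArg Prod.snd ((quadraticAdeleEquiv F E c hcδ hδ).injective hx)
  have h22 : p.2 + p.2 = 0 := by
    nth_rw 1 [← h2]
    exact neg_add_cancel p.2
  refine ⟨p.1, ?_⟩
  rw [hy, quadraticAdeleEquiv_apply, adele_eq_zero_of_add_self_eq_zero h22, map_zero, zero_mul, add_zero]

include hcδ hδ in
/-- `c ⊗ 1`-fixed adeles = the range of the base change `𝔸_F → 𝔸_E`. [cite: CasselsFrohlichANT1967, Ch. II §14] -/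
theorem conjAdele_eq_self_iff_mem_range_baseChange (x : AdeleRing (𝓞 E) E) :
    conjAdele F E c x = x ↔ x ∈ Set.range (AdeleRing.baseChange F E) := by
  constructor
  · intro hx
    obtain ⟨a, ha⟩ := exists_baseChange_eq_of_conjAdele_eq E c hcδ hδ hx
    exact ⟨a, ha⟩
  · rintro ⟨a, rfl⟩
    rw [conjAdele_apply, AdeleRing.smul_baseChange]

include hcδ hδ in
/-- **Quadratic Galois descent for ideles**: a `c ⊗ 1`-fixed idele `λ` of `E` is `a ⊗ 1` for an idele `a`
of `F` (descend `λ` and `λ⁻¹` and use injectivity of the base change). Hence every scaling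
`smulTraceZero λ` of `𝔸_E⁻` by a `c`-fixed idele is conjugate under `θ` to multiplication by an idele of
`F` (`traceZeroLine_units_mul`). [cite: CasselsFrohlichANT1967, Ch. II §14] -/
theorem exists_ideleBaseChange_eq_of_conjAdele_eq {l : (AdeleRing (𝓞 E) E)ˣ}
    (hl : conjAdele F E c (l : AdeleRing (𝓞 E) E) = l) :
    ∃ a : (AdeleRing (𝓞 F) F)ˣ, AdeleRing.ideleBaseChange F E a = l := by
  obtain ⟨a, ha⟩ := exists_baseChange_eq_of_conjAdele_eq E c hcδ hδ hl
  obtain ⟨b, hb⟩ := exists_baseChange_eq_of_conjAdele_eq E c hcδ hδ (conjAdele_units_inv_of_fixed l hl)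
  have hab : a * b = 1 := AdeleRing.baseChange_injective F E (by
    rw [map_mul, ha, hb, map_one, Units.mul_inv])
  have hba : b * a = 1 := by rw [mul_comm, hab]
  exact ⟨⟨a, b, hab, hba⟩, Units.ext ha⟩

/-! ## §3 Rational points: `θ(F) = E⁻` and the lattice-sum dictionary -/

/-- `θ(x) = (x δ)_{𝔸_E}` for `x ∈ F`. [cite: Rogawski1990, §1.10] -/
theorem coe_traceZeroLine_algebraMap (x : F) :
    ((traceZeroLine F E c hcδ hδ (algebraMap F (AdeleRing (𝓞 F) F) x) : traceZeroAdele F E c) : AdeleRing (𝓞 E) E) =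
      algebraMap E (AdeleRing (𝓞 E) E) (algebraMap F E x * δ) := by
  rw [coe_traceZeroLine, AdeleRing.baseChange_algebraMap, map_mul]

/-- `θ` maps `F` into the principal trace-zero adeles `E⁻`. [cite: Rogawski1990, §1.10] -/
theorem traceZeroLine_algebraMap_mem_rationalTraceZero (x : F) :
    traceZeroLine F E c hcδ hδ (algebraMap F (AdeleRing (𝓞 F) F) x) ∈ rationalTraceZero F E c :=
  (mem_rationalTraceZero_iff _).2 ⟨algebraMap F E x * δ, (coe_traceZeroLine_algebraMap E c hcδ hδ x).symm⟩

/-- **`θ(F) = E⁻`**: every principal trace-zero adele is `θ(x)` for a (unique) `x ∈ F` (a principal adele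
`ξ` with `(c ⊗ 1) ξ = -ξ` has `c ξ = -ξ`, so `ξ = x δ`). [cite: Rogawski1990, §1.10] -/
theorem exists_traceZeroLine_algebraMap_eq {w : traceZeroAdele F E c} (hw : w ∈ rationalTraceZero F E c) :
    ∃ x : F, traceZeroLine F E c hcδ hδ (algebraMap F (AdeleRing (𝓞 F) F) x) = w := by
  obtain ⟨ξ, hξ⟩ := (mem_rationalTraceZero_iff _).1 hw
  have hcξ : c ξ = -ξ := by
    apply AdeleRing.algebraMap_injective (𝓞 E) E
    have h := (mem_traceZeroAdele_iff _).1 w.2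
    rw [← hξ, ← algebraMap_conj, RingHom.coe_coe, ← map_neg] at h
    exact h
  obtain ⟨x, hx⟩ := exists_eq_algebraMap_mul_of_conj_eq_neg E c hcδ hδ hcξ
  exact ⟨x, Subtype.ext (by rw [coe_traceZeroLine_algebraMap, ← hx, hξ])⟩

/-- `θ ∘ (F → 𝔸_F)` is injective (`t ↦ t δ₀` is injective on `F`). [cite: Rogawski1990, §7.2 p. 95] -/
theorem traceZeroLine_algebraMap_injective :
    Function.Injective fun x : F => traceZeroLine F E c hcδ hδ (algebraMap F (AdeleRing (𝓞 F) F) x) :=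
  fun _ _ h => AdeleRing.algebraMap_injective (𝓞 F) F ((traceZeroLine F E c hcδ hδ).injective h)

variable (F) in
/-- **`F ≃+ E⁻` along the line**: `x ↦ θ(x) = (x δ)_{𝔸_E}`, the identification of the base field with
the lattice of principal trace-zero adeles (rational points of the centre of `N`). [cite: Rogawski1990, §1.10] -/
def rationalTraceZeroEquiv : F ≃+ rationalTraceZero F E c :=
  { (Equiv.ofBijective
      (fun x : F => (⟨traceZeroLine F E c hcδ hδ (algebraMap F (AdeleRing (𝓞 F) F) x),
        traceZeroLine_algebraMap_mem_rationalTraceZero E c hcδ hδ x⟩ : rationalTraceZero F E c))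
      ⟨fun a b h => traceZeroLine_algebraMap_injective E c hcδ hδ (congrArg Subtype.val h),
        fun w => by
          obtain ⟨x, hx⟩ := exists_traceZeroLine_algebraMap_eq E c hcδ hδ w.2
          exact ⟨x, Subtype.ext hx⟩⟩) with
    map_add' := fun a b => Subtype.ext (by
      change traceZeroLine F E c hcδ hδ (algebraMap F (AdeleRing (𝓞 F) F) (a + b)) =
        traceZeroLine F E c hcδ hδ (algebraMap F (AdeleRing (𝓞 F) F) a) +
          traceZeroLine F E c hcδ hδ (algebraMap F (AdeleRing (𝓞 F) F) b)
      rw [map_add, map_add]) }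

/-- `rationalTraceZeroEquiv x = θ(x)` in `𝔸_E⁻` (definitional). [cite: Rogawski1990, §1.10] -/
@[simp] theorem coe_rationalTraceZeroEquiv (x : F) :
    ((rationalTraceZeroEquiv F E c hcδ hδ x : rationalTraceZero F E c) : traceZeroAdele F E c) =
      traceZeroLine F E c hcδ hδ (algebraMap F (AdeleRing (𝓞 F) F) x) := rfl

/-- `rationalTraceZeroEquiv x = (x δ)_{𝔸_E}` as an adele. [cite: Rogawski1990, §1.10] -/
theorem coe_coe_rationalTraceZeroEquiv (x : F) :
    (((rationalTraceZeroEquiv F E c hcδ hδ x : rationalTraceZero F E c) : traceZeroAdele F E c) : AdeleRing (𝓞 E) E) =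
      algebraMap E (AdeleRing (𝓞 E) E) (algebraMap F E x * δ) :=
  coe_traceZeroLine_algebraMap E c hcδ hδ x

/-- `rationalTraceZeroEquiv x ≠ 0 ↔ x ≠ 0` (`t δ₀ ≠ 0 ↔ t ≠ 0`). [cite: Rogawski1990, §7.2 p. 95] -/
theorem rationalTraceZeroEquiv_ne_zero_iff (x : F) : rationalTraceZeroEquiv F E c hcδ hδ x ≠ 0 ↔ x ≠ 0 :=
  (map_ne_zero_iff _ (rationalTraceZeroEquiv F E c hcδ hδ).injective)

variable (F) in
/-- `Fˣ ≃ E⁻ ∖ 0` along the line (the index set of the non-zero lattice points). [cite: Rogawski1990, §1.10] -/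
def unitsEquivRationalTraceZeroNeZero : Fˣ ≃ {w : rationalTraceZero F E c // w ≠ 0} :=
  unitsEquivNeZero.trans ((rationalTraceZeroEquiv F E c hcδ hδ).toEquiv.subtypeEquiv
    fun x => (rationalTraceZeroEquiv_ne_zero_iff E c hcδ hδ x).symm)

/-- `unitsEquivRationalTraceZeroNeZero a = θ(a)` in `𝔸_E⁻` (definitional). [cite: Rogawski1990, §1.10] -/
@[simp] theorem coe_unitsEquivRationalTraceZeroNeZero (a : Fˣ) :
    (((unitsEquivRationalTraceZeroNeZero F E c hcδ hδ a : {w : rationalTraceZero F E c // w ≠ 0}) :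
        rationalTraceZero F E c) : traceZeroAdele F E c) =
      traceZeroLine F E c hcδ hδ (algebraMap F (AdeleRing (𝓞 F) F) (a : F)) := rfl

/-- **The lattice-sum dictionary**: for every `ψ : 𝔸_E⁻ → ℂ` and idele `a` of `F`,
`Σ_{ξ ∈ Fˣ} ψ(θ(ξ a)) = Σ_{w ∈ E⁻ ∖ 0} ψ((a ⊗ 1) w)` — Tate's idele sum ★ `ideleSum F (ψ ∘ θ) a` is the
sum of `ψ` over the non-zero points of the lattice `E⁻` scaled by the `c`-fixed idele `a ⊗ 1`
(reindex along `Fˣ ≃ E⁻ ∖ 0`; no summability needed). This is the step "the sum over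
`t ∈ F^*` of `ψ(α t δ₀)`" of Rogawski's (7.2.3). [cite: Rogawski1990, §7.2 (7.2.3)] -/
theorem ideleSum_comp_traceZeroLine (ψ : traceZeroAdele F E c → ℂ) (a : (AdeleRing (𝓞 F) F)ˣ) :
    Meyer.ideleSum F (fun t => ψ (traceZeroLine F E c hcδ hδ t)) a =
      ∑' w : {w : rationalTraceZero F E c // w ≠ 0},
        ψ (smulTraceZero (AdeleRing.ideleBaseChange F E a) (conjAdele_ideleBaseChange E c a)
          ((w : rationalTraceZero F E c) : traceZeroAdele F E c)) := by
  unfold Meyer.ideleSum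
  rw [← Equiv.tsum_eq (unitsEquivRationalTraceZeroNeZero F E c hcδ hδ)]
  refine tsum_congr fun ξ => ?_
  rw [coe_unitsEquivRationalTraceZeroNeZero, ← traceZeroLine_mul_units]

/-- The same dictionary for sums over ALL of `F` / `E⁻`: `Σ_{x ∈ F} G(θ x) = Σ_{w ∈ E⁻} G(w)`.
[cite: Rogawski1990, §7.2 (7.2.3)] -/
theorem tsum_comp_traceZeroLine_algebraMap {M : Type*} [AddCommMonoid M] [TopologicalSpace M]
    (G : traceZeroAdele F E c → M) :
    ∑' x : F, G (traceZeroLine F E c hcδ hδ (algebraMap F (AdeleRing (𝓞 F) F) x)) =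
      ∑' w : rationalTraceZero F E c, G ((w : rationalTraceZero F E c) : traceZeroAdele F E c) := by
  rw [← Equiv.tsum_eq (rationalTraceZeroEquiv F E c hcδ hδ).toEquiv]
  rfl

end Line

end UnitaryGroup

end Literature.NumberTheory.Automorphic

end
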